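import Literature.Geometry.Lorentzian.KerrStarPlancherel
import Literature.Geometry.Lorentzian.KerrStarSphereGreen
import HarnessLib

/-!
# The Carter-symbol Plancherel inequality at first order (DRSR §5.2.2 / §10, `k = 1`)

Dafermos–Rodnianski–Shlapentokh-Rothman, arXiv:1402.7034, §5.2.2 ("Plancherel") with §5.2.1 (32)–(34) and
the first-order case of Prop. 10.1: in the Carter separation the weight `Λ = λ_{mℓ}(aω) + a²ω²` of a mode
`(ω, m, ℓ)` is the symbol of the (modified) CARTER OPERATOR `𝒬 = -Δ̸_{S²} - a² sin²θ ∂_{t*}²`, so the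
`(1 + ω² + Λ)`-weighted Parseval–Plancherel sum of the oblate coefficients of a function is a FIRST-ORDER
physical-space energy of that function on the spheres `{t*, r = const}` — no `r`-weights, no wave equation,
no surface gravity. In the tree's `L²` separation (time Fourier transform `Kerr.freqLp` of the star-chart
slices `Kerr.angSlice`, oblate Hilbert basis `oblateSphereBasis (2π) ν`, `ν = aω`, `ω = -2πξ`):

* `Kerr.inner_mulSqFst_re_nonneg` — `0 ≤ Re ⟪G, cos²θ · G⟫` on `𝓚 = L²([-1, 1] × 𝕋)`;
* `Kerr.neg_inner_angSlice_sphLaplacianStar_re_nonneg` — `0 ≤ -Re ⟪F(t*, r, ·), Δ̸F(t*, r, ·)⟫` (the angular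
  Dirichlet energy; weak-Laplacian positivity `Kerr.inner_weakLaplacian_re_nonneg`);
* `Kerr.ae_tsum_carterSymbol_le` — for a.e. `ξ`, with `û = 𝓕_{t*}F(r, ·)(ξ)`, `F = Φ ∘ κ_a`, the series
  `∑_q (1 + ω² + Λ_q) |⟪Ψ_q(aω), û⟫|²` has non-negative terms, converges, and is
  `≤ ‖û‖² + (1 + a²)‖(∂_{t*}F)^(ξ)‖² - Re ⟪û, (Δ̸F)^(ξ)⟫`, the last term being `≥ 0`
  (angular Parseval with the eigenvalue weight `Kerr.ae_hasSum_eig_mul_norm_sq`, Parseval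
  `hasSum_sq_norm_inner_oblateSphereBasis`, `∂_{t*} ↦ 2πiξ` `Kerr.ae_norm_freqLp_dir0`, and
  `Λ_q - λ_q = ν² = a²ω²`, `-ν² Re⟪û, cos²θ û⟫ ≤ 0`);
* `Kerr.carterSymbol_plancherel_one` — **the `k = 1` Carter-symbol Plancherel inequality**: for
  `Φ ∈ C²(ℝ⁴)` with time-square-integrable slices of `F`, `∂_{t*}F`, `Δ̸F` and `r > 0`,
  `∫dξ ∑_q (1 + ω² + Λ_q)|⟪Ψ_q(aω), û(r, ξ)⟫|²
     ≤ ∫dt* ( ‖F(t*, r, ·)‖² + (1 + a²)‖∂_{t*}F(t*, r, ·)‖² - Re ⟪F(t*, r, ·), Δ̸F(t*, r, ·)⟫ )`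
  in `𝓚`, stated in `ℝ≥0∞` (Plancherel in `t*`, `Kerr.lintegral_enorm_sq_freqLp`,
  `Kerr.integral_inner_freqLp`); the last term is the angular Dirichlet energy
  `(2π)⁻¹ ∫∫ (sin θ (∂_θF)² + (∂_φF)²/sin θ)` by Green's identity on the slices
  (`Kerr.inner_angSlice_sphLaplacianStar`).

This is the input "S5 at `k = 1`" of the DRSR §9 summation for the time cut-off of a future-integrable wave
(crux `PhaseMixingCapture.KappaExplicitWaveDecay`): the `Λ`-weights of near sources are paid by ONE angular
derivative on a bounded region. Higher `k` iterates the same identities with `Λ_q⟪Ψ_q, û⟫ = ⟪Ψ_q, (𝒬F)^⟫`.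

## References

* M. Dafermos, I. Rodnianski, Y. Shlapentokh-Rothman, arXiv:1402.7034, §5.2.1 (32)–(34), §5.2.2, Prop. 10.1.
  [DafermosRodnianskiShlapentokhrothman2014]
-/

noncomputable section

open Real Set Filter MeasureTheory Function
open scoped Topology ENNReal InnerProductSpace ComplexConjugate FourierTransform

namespace Literature.Geometry.Lorentzian

namespace Kerr

open Literature.Analysis.SpecialFunctions Literature.Analysis.FunctionSpaces
  Literature.Analysis.Fourier

variable [h2π : Fact (0 < 2 * π)]

/-! ### Two positivity facts -/

/-- **`0 ≤ Re ⟪G, cos²θ · G⟫`**: multiplication by `x² = cos²θ` is a non-negative operator on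
`𝓚 = L²([-1, 1] × 𝕋)`. [folklore] -/
theorem inner_mulSqFst_re_nonneg (G : AngSpace) : 0 ≤ (⟪G, mulSqFst (2 * π) G⟫_ℂ).re := by
  rw [← RCLike.re_to_complex, L2.inner_def,
    ← integral_re (L2.integrable_inner (𝕜 := ℂ) G (mulSqFst (2 * π) G))]
  refine integral_nonneg_of_ae ?_
  filter_upwards [coeFn_mulSqFst (T := 2 * π) G] with z hz
  rw [hz, show ((z.1 ^ 2 : ℝ) : ℂ) * G z = ((z.1 ^ 2 : ℝ) : ℂ) • G z from rfl, inner_smul_right,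
    Pi.zero_apply, RCLike.re_to_complex, Complex.re_ofReal_mul, ← RCLike.re_to_complex,
    inner_self_eq_norm_sq]
  positivity

/-- **`0 ≤ -Re ⟪F(t*, r, ·), Δ̸F(t*, r, ·)⟫`** for `F = Φ ∘ κ_a`, `Φ ∈ C²`, `r > 0`: the slice of the angular
Laplacian is the weak Laplacian of the slice (`Kerr.inner_sphHarmTensor_angSlice_sphLaplacianStar`), and
`Re ⟪u, -Δ̸u⟫ = ∑ ℓ(ℓ+1)|u_{mℓ}|² ≥ 0` (`Kerr.inner_weakLaplacian_re_nonneg`).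
[cite: DafermosRodnianskiShlapentokhrothman2014, §5.2.2] -/
theorem neg_inner_angSlice_sphLaplacianStar_re_nonneg (a : ℝ) {Φ : E4 → ℝ} (hΦ : ContDiff ℝ 2 Φ)
    {t r : ℝ} (hr : 0 < r) :
    0 ≤ -(⟪angSlice (starPull a Φ) (contDiff_two_starPull a hΦ).continuous t r,
        angSlice (sphLaplacianStar a Φ) (continuous_sphLaplacianStar a hΦ) t r⟫_ℂ).re := by
  have hpair : ∀ (m : ℤ) (k : ℕ), ⟪sphHarmTensor (2 * π) m k,
      -angSlice (sphLaplacianStar a Φ) (continuous_sphLaplacianStar a hΦ) t r⟫_ℂ =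
      (assocLegLevel m.natAbs k : ℂ) * ⟪sphHarmTensor (2 * π) m k,
        angSlice (starPull a Φ) (contDiff_two_starPull a hΦ).continuous t r⟫_ℂ := fun m k ↦ by
    rw [inner_neg_right, inner_sphHarmTensor_angSlice_sphLaplacianStar a hΦ hr m k]
    ring
  have h := inner_weakLaplacian_re_nonneg _ _ hpair
  rwa [inner_neg_right, Complex.neg_re] at h

/-! ### The pointwise-in-frequency symbol bound -/

/-- **The symbol bound at a.e. frequency.** For a.e. `ξ`, with `ω = -2πξ`, `ν = aω`, `û = 𝓕_{t*}F(r, ·)(ξ)`,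
`v̂ = (∂_{t*}F)^(ξ)`, `Ŝ = (Δ̸F)^(ξ)`: every term `(1 + ω² + Λ_q)|⟪Ψ_q(ν), û⟫|²`, `Λ_q = λ_q(ν) + ν²`, is
non-negative, the series converges, `0 ≤ -Re⟪û, Ŝ⟫`, and
`∑_q (1 + ω² + Λ_q)|⟪Ψ_q(ν), û⟫|² ≤ ‖û‖² + (1 + a²)‖v̂‖² - Re⟪û, Ŝ⟫`
(`= (1 + ω² + ν²)‖û‖² - Re⟪û, Ŝ⟫ - ν² Re⟪û, cos²θ û⟫` exactly; `ω²‖û‖² = ‖v̂‖²`, `ν² = a²ω²`).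
[cite: DafermosRodnianskiShlapentokhrothman2014, §5.2.2; §5.3] -/
theorem ae_tsum_carterSymbol_le (a : ℝ) {Φ : E4 → ℝ} (hΦ : ContDiff ℝ 2 Φ)
    (hIF : ∀ r, TimeSqInt (starPull a Φ) (contDiff_two_starPull a hΦ).continuous r)
    (hI0 : ∀ r, TimeSqInt (dir 0 (starPull a Φ))
      (continuous_dir (contDiff_one_starPull a hΦ) one_ne_zero 0) r)
    (hIS : ∀ r, TimeSqInt (sphLaplacianStar a Φ) (continuous_sphLaplacianStar a hΦ) r) {r : ℝ}
    (hr : 0 < r) :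
    ∀ᵐ ξ ∂volume,
      (∀ q : OblateSphereIndex (a * (-2 * π * ξ)), 0 ≤ (1 + (2 * π * ξ) ^ 2 +
            (oblateSphereEig (a * (-2 * π * ξ)) q + a ^ 2 * (-2 * π * ξ) ^ 2)) *
          ‖⟪oblateSphereBasis (2 * π) (a * (-2 * π * ξ)) q,
              (freqLp (starPull a Φ) (contDiff_two_starPull a hΦ).continuous hIF r :
                ℝ → AngSpace) ξ⟫_ℂ‖ ^ 2) ∧
      Summable (fun q : OblateSphereIndex (a * (-2 * π * ξ)) ↦ (1 + (2 * π * ξ) ^ 2 +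
            (oblateSphereEig (a * (-2 * π * ξ)) q + a ^ 2 * (-2 * π * ξ) ^ 2)) *
          ‖⟪oblateSphereBasis (2 * π) (a * (-2 * π * ξ)) q,
              (freqLp (starPull a Φ) (contDiff_two_starPull a hΦ).continuous hIF r :
                ℝ → AngSpace) ξ⟫_ℂ‖ ^ 2) ∧
      0 ≤ -(⟪(freqLp (starPull a Φ) (contDiff_two_starPull a hΦ).continuous hIF r : ℝ → AngSpace) ξ,
          (freqLp (sphLaplacianStar a Φ) (continuous_sphLaplacianStar a hΦ) hIS r :
            ℝ → AngSpace) ξ⟫_ℂ).re ∧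
      ∑' q : OblateSphereIndex (a * (-2 * π * ξ)), (1 + (2 * π * ξ) ^ 2 +
            (oblateSphereEig (a * (-2 * π * ξ)) q + a ^ 2 * (-2 * π * ξ) ^ 2)) *
          ‖⟪oblateSphereBasis (2 * π) (a * (-2 * π * ξ)) q,
              (freqLp (starPull a Φ) (contDiff_two_starPull a hΦ).continuous hIF r :
                ℝ → AngSpace) ξ⟫_ℂ‖ ^ 2 ≤
        ‖(freqLp (starPull a Φ) (contDiff_two_starPull a hΦ).continuous hIF r : ℝ → AngSpace) ξ‖ ^ 2 +
          (1 + a ^ 2) * ‖(freqLp (dir 0 (starPull a Φ))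
            (continuous_dir (contDiff_one_starPull a hΦ) one_ne_zero 0) hI0 r : ℝ → AngSpace) ξ‖ ^ 2 -
          (⟪(freqLp (starPull a Φ) (contDiff_two_starPull a hΦ).continuous hIF r : ℝ → AngSpace) ξ,
            (freqLp (sphLaplacianStar a Φ) (continuous_sphLaplacianStar a hΦ) hIS r :
              ℝ → AngSpace) ξ⟫_ℂ).re := by
  filter_upwards [ae_hasSum_eig_mul_norm_sq a hΦ hIF hIS hr,
    ae_norm_freqLp_dir0 (contDiff_one_starPull a hΦ) hIF hI0 r,
    ae_laplacianPair a hΦ hIF hIS hr] with ξ hE hD hL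
  -- notation: `U = û(ξ)`, `V = v̂(ξ)`, `S = Ŝ(ξ)`
  set U : AngSpace := (freqLp (starPull a Φ) (contDiff_two_starPull a hΦ).continuous hIF r :
    ℝ → AngSpace) ξ with hU
  set V : AngSpace := (freqLp (dir 0 (starPull a Φ))
    (continuous_dir (contDiff_one_starPull a hΦ) one_ne_zero 0) hI0 r : ℝ → AngSpace) ξ with hV
  set S : AngSpace := (freqLp (sphLaplacianStar a Φ) (continuous_sphLaplacianStar a hΦ) hIS r :
    ℝ → AngSpace) ξ with hS
  -- the three inputs at this frequency
  have hP := hasSum_sq_norm_inner_oblateSphereBasis (T := 2 * π) (a * (-2 * π * ξ)) U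
  have hE' := hE (a * (-2 * π * ξ))
  have hx := inner_mulSqFst_re_nonneg U
  -- non-negativity of the weights: `Λ_q = λ_q + ν² ≥ |m|(|m|+1) ≥ 0`
  have hw : ∀ q : OblateSphereIndex (a * (-2 * π * ξ)),
      0 ≤ 1 + (2 * π * ξ) ^ 2 + (oblateSphereEig (a * (-2 * π * ξ)) q + a ^ 2 * (-2 * π * ξ) ^ 2) := by
    intro q
    have h1 := le_oblateSphereEig (a * (-2 * π * ξ)) q
    nlinarith [abs_nonneg (q.1 : ℝ), sq_nonneg (2 * π * ξ)]
  -- the weighted series is `(1 + ω² + ν²)·Parseval + eigenvalue series`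
  have hsum : HasSum (fun q : OblateSphereIndex (a * (-2 * π * ξ)) ↦ (1 + (2 * π * ξ) ^ 2 +
        (oblateSphereEig (a * (-2 * π * ξ)) q + a ^ 2 * (-2 * π * ξ) ^ 2)) *
      ‖⟪oblateSphereBasis (2 * π) (a * (-2 * π * ξ)) q, U⟫_ℂ‖ ^ 2)
      ((1 + (2 * π * ξ) ^ 2 + a ^ 2 * (-2 * π * ξ) ^ 2) * ‖U‖ ^ 2 +
        (-(⟪U, S⟫_ℂ).re - (a * (-2 * π * ξ)) ^ 2 * (⟪U, mulSqFst (2 * π) U⟫_ℂ).re)) := by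
    have hfun : (fun q : OblateSphereIndex (a * (-2 * π * ξ)) ↦ (1 + (2 * π * ξ) ^ 2 +
        (oblateSphereEig (a * (-2 * π * ξ)) q + a ^ 2 * (-2 * π * ξ) ^ 2)) *
          ‖⟪oblateSphereBasis (2 * π) (a * (-2 * π * ξ)) q, U⟫_ℂ‖ ^ 2) =
        fun q ↦ (1 + (2 * π * ξ) ^ 2 + a ^ 2 * (-2 * π * ξ) ^ 2) *
            ‖⟪oblateSphereBasis (2 * π) (a * (-2 * π * ξ)) q, U⟫_ℂ‖ ^ 2 +
          oblateSphereEig (a * (-2 * π * ξ)) q *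
            ‖⟪oblateSphereBasis (2 * π) (a * (-2 * π * ξ)) q, U⟫_ℂ‖ ^ 2 := by
      funext q; ring
    rw [hfun]
    exact (hP.mul_left _).add hE'
  -- positivity of `-Re⟪U, S⟫` from the transported Laplacian pair condition
  have hpos : 0 ≤ -(⟪U, S⟫_ℂ).re := by
    have hpair : ∀ (m : ℤ) (k : ℕ), ⟪sphHarmTensor (2 * π) m k, -S⟫_ℂ =
        (assocLegLevel m.natAbs k : ℂ) * ⟪sphHarmTensor (2 * π) m k, U⟫_ℂ := fun m k ↦ by
      rw [inner_neg_right, hL (m, k)]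
      ring
    have h := inner_weakLaplacian_re_nonneg U (-S) hpair
    rwa [inner_neg_right, Complex.neg_re] at h
  -- `‖V‖² = ω² ‖U‖²`
  have hV2 : ‖V‖ ^ 2 = (2 * π * ξ) ^ 2 * ‖U‖ ^ 2 := by
    rw [hD, mul_pow, mul_pow, sq_abs]
    ring
  refine ⟨fun q ↦ mul_nonneg (hw q) (sq_nonneg _), hsum.summable, hpos, ?_⟩
  rw [hsum.tsum_eq, hV2]
  have hν : 0 ≤ (a * (-2 * π * ξ)) ^ 2 * (⟪U, mulSqFst (2 * π) U⟫_ℂ).re :=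
    mul_nonneg (sq_nonneg _) hx
  nlinarith [hν, sq_nonneg a, sq_nonneg (2 * π * ξ), norm_nonneg U, sq_nonneg ‖U‖]

/-! ### The `k = 1` Carter-symbol Plancherel inequality -/

/-- **Integrability in `t*` of `⟪F(t*, r, ·), G(t*, r, ·)⟫_𝓚`** for time-square-integrable slices
(Cauchy–Schwarz in `L²(ℝ_{t*}; 𝓚)`). [folklore] -/
theorem integrable_inner_angSlice (G₁ : E4 → ℝ) (h₁ : Continuous G₁) (hI₁ : ∀ r, TimeSqInt G₁ h₁ r)
    (G₂ : E4 → ℝ) (h₂ : Continuous G₂) (hI₂ : ∀ r, TimeSqInt G₂ h₂ r) (r : ℝ) :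
    Integrable (fun t ↦ ⟪angSlice G₁ h₁ t r, angSlice G₂ h₂ t r⟫_ℂ) (volume : Measure ℝ) := by
  have h := L2.integrable_inner (𝕜 := ℂ) (timeLp G₁ h₁ hI₁ r) (timeLp G₂ h₂ hI₂ r)
  refine h.congr ?_
  filter_upwards [coeFn_timeLp G₁ h₁ hI₁ r, coeFn_timeLp G₂ h₂ hI₂ r] with t ht₁ ht₂
  rw [ht₁, ht₂]

/-- **Three non-negative densities add up inside `∫⁻`** (reassembly of the physical side). [folklore] -/
theorem lintegral_three_le_lintegral_ofReal (F₀ F₁ F₂ : ℝ → AngSpace) {c : ℝ} (hc : 0 ≤ c)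
    (hp : ∀ t, 0 ≤ -(⟪F₀ t, F₂ t⟫_ℂ).re) :
    (∫⁻ t, ENNReal.ofReal (‖F₀ t‖ ^ 2)) + ENNReal.ofReal c * (∫⁻ t, ENNReal.ofReal (‖F₁ t‖ ^ 2)) +
        ∫⁻ t, ENNReal.ofReal (-(⟪F₀ t, F₂ t⟫_ℂ).re) ≤
      ∫⁻ t, ENNReal.ofReal (‖F₀ t‖ ^ 2 + c * ‖F₁ t‖ ^ 2 - (⟪F₀ t, F₂ t⟫_ℂ).re) := by
  rw [← lintegral_const_mul' _ _ ENNReal.ofReal_ne_top]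
  refine (add_le_add (le_lintegral_add _ _) le_rfl).trans ((le_lintegral_add _ _).trans (le_of_eq ?_))
  refine lintegral_congr fun t ↦ ?_
  rw [← ENNReal.ofReal_mul hc, ← ENNReal.ofReal_add (sq_nonneg _) (mul_nonneg hc (sq_nonneg _)),
    ← ENNReal.ofReal_add (add_nonneg (sq_nonneg _) (mul_nonneg hc (sq_nonneg _))) (hp t),
    ← sub_eq_add_neg]

/-- **Splitting the frequency side into three integrals.** [folklore] -/
theorem lintegral_freq_split (U V S : Lp AngSpace 2 (volume : Measure ℝ)) {c : ℝ} (hc : 0 ≤ c) :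
    ∫⁻ ξ, (ENNReal.ofReal (‖(U : ℝ → AngSpace) ξ‖ ^ 2) +
        ENNReal.ofReal (c * ‖(V : ℝ → AngSpace) ξ‖ ^ 2) +
        ENNReal.ofReal (-(⟪(U : ℝ → AngSpace) ξ, (S : ℝ → AngSpace) ξ⟫_ℂ).re)) =
      (∫⁻ ξ, ENNReal.ofReal (‖(U : ℝ → AngSpace) ξ‖ ^ 2)) +
        ENNReal.ofReal c * (∫⁻ ξ, ENNReal.ofReal (‖(V : ℝ → AngSpace) ξ‖ ^ 2)) +
        ∫⁻ ξ, ENNReal.ofReal (-(⟪(U : ℝ → AngSpace) ξ, (S : ℝ → AngSpace) ξ⟫_ℂ).re) := by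
  have hmU : AEMeasurable (fun ξ ↦ ENNReal.ofReal (‖(U : ℝ → AngSpace) ξ‖ ^ 2)) volume :=
    ((Lp.aestronglyMeasurable U).norm.aemeasurable.pow_const 2).ennreal_ofReal
  have hmV : AEMeasurable (fun ξ ↦ ENNReal.ofReal (c * ‖(V : ℝ → AngSpace) ξ‖ ^ 2)) volume :=
    (((Lp.aestronglyMeasurable V).norm.aemeasurable.pow_const 2).const_mul _).ennreal_ofReal
  have hmUV : AEMeasurable (fun ξ ↦ ENNReal.ofReal (‖(U : ℝ → AngSpace) ξ‖ ^ 2) +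
      ENNReal.ofReal (c * ‖(V : ℝ → AngSpace) ξ‖ ^ 2)) volume := hmU.add hmV
  rw [lintegral_add_left' hmUV, lintegral_add_left' hmU, ← lintegral_const_mul' _ _ ENNReal.ofReal_ne_top]
  congr 2
  refine lintegral_congr fun ξ ↦ ?_
  rw [ENNReal.ofReal_mul hc]

omit h2π in
/-- `∫ -(f x).re = -(∫ f).re` for an integrable complex-valued `f`. [folklore] -/
theorem integral_neg_re {f : ℝ → ℂ} (hf : Integrable f (volume : Measure ℝ)) :
    ∫ x, -(f x).re = -(∫ x, f x).re := by
  rw [integral_neg]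
  congr 1
  have h := integral_re hf
  simpa only [RCLike.re_to_complex] using h

/-- **The Carter-symbol Plancherel inequality at first order** (DRSR §5.2.2 with (32)–(34); Prop. 10.1 at
`k = 1`): for `Φ ∈ C²(ℝ⁴)` whose star-chart slices of `F = Φ ∘ κ_a`, `∂_{t*}F` and `Δ̸F` are square
integrable in `t*` at every radius, and `r > 0`,
`∫dξ ∑_q (1 + ω² + Λ_q)|⟪Ψ_q(aω), û(r, ξ)⟫|²
   ≤ ∫dt* ( ‖F(t*, r, ·)‖²_𝓚 + (1 + a²)‖∂_{t*}F(t*, r, ·)‖²_𝓚 - Re⟪F(t*, r, ·), Δ̸F(t*, r, ·)⟫_𝓚 )`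
(`ω = -2πξ`, `Λ_q = λ_q(aω) + a²ω²`; the integrand on the right is non-negative term by term, the last term
being the angular Dirichlet energy `(2π)⁻¹∫∫(sin θ(∂_θF)² + (∂_φF)²/sin θ)` by
`Kerr.inner_angSlice_sphLaplacianStar`). The `Λ`-weight costs exactly one angular derivative and NO radial
weight. [cite: DafermosRodnianskiShlapentokhrothman2014, §5.2.2; Prop. 10.1] -/
theorem carterSymbol_plancherel_one (a : ℝ) {Φ : E4 → ℝ} (hΦ : ContDiff ℝ 2 Φ)
    (hIF : ∀ r, TimeSqInt (starPull a Φ) (contDiff_two_starPull a hΦ).continuous r)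
    (hI0 : ∀ r, TimeSqInt (dir 0 (starPull a Φ))
      (continuous_dir (contDiff_one_starPull a hΦ) one_ne_zero 0) r)
    (hIS : ∀ r, TimeSqInt (sphLaplacianStar a Φ) (continuous_sphLaplacianStar a hΦ) r) {r : ℝ}
    (hr : 0 < r) :
    ∫⁻ ξ, ∑' q : OblateSphereIndex (a * (-2 * π * ξ)),
        ENNReal.ofReal ((1 + (2 * π * ξ) ^ 2 +
            (oblateSphereEig (a * (-2 * π * ξ)) q + a ^ 2 * (-2 * π * ξ) ^ 2)) *
          ‖⟪oblateSphereBasis (2 * π) (a * (-2 * π * ξ)) q,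
              (freqLp (starPull a Φ) (contDiff_two_starPull a hΦ).continuous hIF r :
                ℝ → AngSpace) ξ⟫_ℂ‖ ^ 2) ≤
      ∫⁻ t, ENNReal.ofReal (‖angSlice (starPull a Φ) (contDiff_two_starPull a hΦ).continuous t r‖ ^ 2 +
        (1 + a ^ 2) * ‖angSlice (dir 0 (starPull a Φ))
          (continuous_dir (contDiff_one_starPull a hΦ) one_ne_zero 0) t r‖ ^ 2 -
        (⟪angSlice (starPull a Φ) (contDiff_two_starPull a hΦ).continuous t r,
          angSlice (sphLaplacianStar a Φ) (continuous_sphLaplacianStar a hΦ) t r⟫_ℂ).re) := by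
  -- notation for the three frequency classes
  set U := freqLp (starPull a Φ) (contDiff_two_starPull a hΦ).continuous hIF r with hU
  set V := freqLp (dir 0 (starPull a Φ)) (continuous_dir (contDiff_one_starPull a hΦ) one_ne_zero 0)
    hI0 r with hV
  set S := freqLp (sphLaplacianStar a Φ) (continuous_sphLaplacianStar a hΦ) hIS r with hS
  have hc : 0 ≤ 1 + a ^ 2 := by positivity
  -- Step 1: the pointwise bound, integrated
  have h1 : ∫⁻ ξ, ∑' q : OblateSphereIndex (a * (-2 * π * ξ)),
        ENNReal.ofReal ((1 + (2 * π * ξ) ^ 2 +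
            (oblateSphereEig (a * (-2 * π * ξ)) q + a ^ 2 * (-2 * π * ξ) ^ 2)) *
          ‖⟪oblateSphereBasis (2 * π) (a * (-2 * π * ξ)) q, (U : ℝ → AngSpace) ξ⟫_ℂ‖ ^ 2) ≤
      ∫⁻ ξ, (ENNReal.ofReal (‖(U : ℝ → AngSpace) ξ‖ ^ 2) +
        ENNReal.ofReal ((1 + a ^ 2) * ‖(V : ℝ → AngSpace) ξ‖ ^ 2) +
        ENNReal.ofReal (-(⟪(U : ℝ → AngSpace) ξ, (S : ℝ → AngSpace) ξ⟫_ℂ).re)) := by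
    refine lintegral_mono_ae ?_
    filter_upwards [ae_tsum_carterSymbol_le a hΦ hIF hI0 hIS hr] with ξ hξ
    obtain ⟨hnn, hsum, hpos, hle⟩ := hξ
    rw [← ENNReal.ofReal_tsum_of_nonneg hnn hsum, ← ENNReal.ofReal_add (sq_nonneg _)
      (mul_nonneg hc (sq_nonneg _))]
    refine (ENNReal.ofReal_le_ofReal ?_).trans ENNReal.ofReal_add_le
    linarith
  -- Step 2: Plancherel in `t*` for the two norm terms
  have h3U : ∫⁻ ξ, ENNReal.ofReal (‖(U : ℝ → AngSpace) ξ‖ ^ 2) =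
      ∫⁻ t, ENNReal.ofReal (‖angSlice (starPull a Φ) (contDiff_two_starPull a hΦ).continuous t r‖ ^ 2) := by
    simp_rw [ENNReal.ofReal_pow (norm_nonneg _), ofReal_norm]
    exact lintegral_enorm_sq_freqLp _ _ hIF r
  have h3V : ∫⁻ ξ, ENNReal.ofReal (‖(V : ℝ → AngSpace) ξ‖ ^ 2) =
      ∫⁻ t, ENNReal.ofReal (‖angSlice (dir 0 (starPull a Φ))
        (continuous_dir (contDiff_one_starPull a hΦ) one_ne_zero 0) t r‖ ^ 2) := by
    simp_rw [ENNReal.ofReal_pow (norm_nonneg _), ofReal_norm]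
    exact lintegral_enorm_sq_freqLp _ _ hI0 r
  -- Step 3: polarised Plancherel for the Laplacian term (an integrable, a.e. non-negative function)
  have hiUS : Integrable (fun ξ ↦ ⟪(U : ℝ → AngSpace) ξ, (S : ℝ → AngSpace) ξ⟫_ℂ) volume :=
    L2.integrable_inner (𝕜 := ℂ) U S
  have hiUS' : Integrable (fun ξ ↦ -(⟪(U : ℝ → AngSpace) ξ, (S : ℝ → AngSpace) ξ⟫_ℂ).re) volume :=
    hiUS.re.neg
  have hiF : Integrable (fun t ↦ ⟪angSlice (starPull a Φ) (contDiff_two_starPull a hΦ).continuous t r,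
      angSlice (sphLaplacianStar a Φ) (continuous_sphLaplacianStar a hΦ) t r⟫_ℂ) volume :=
    integrable_inner_angSlice _ _ hIF _ _ hIS r
  have hiF' : Integrable (fun t ↦
      -(⟪angSlice (starPull a Φ) (contDiff_two_starPull a hΦ).continuous t r,
        angSlice (sphLaplacianStar a Φ) (continuous_sphLaplacianStar a hΦ) t r⟫_ℂ).re) volume :=
    hiF.re.neg
  have hposξ : 0 ≤ᵐ[volume] fun ξ ↦ -(⟪(U : ℝ → AngSpace) ξ, (S : ℝ → AngSpace) ξ⟫_ℂ).re := by
    filter_upwards [ae_tsum_carterSymbol_le a hΦ hIF hI0 hIS hr] with ξ hξ using hξ.2.2.1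
  have hpost : 0 ≤ᵐ[volume] fun t ↦
      -(⟪angSlice (starPull a Φ) (contDiff_two_starPull a hΦ).continuous t r,
        angSlice (sphLaplacianStar a Φ) (continuous_sphLaplacianStar a hΦ) t r⟫_ℂ).re :=
    ae_of_all _ fun t ↦ neg_inner_angSlice_sphLaplacianStar_re_nonneg a hΦ hr
  have h4 : ∫⁻ ξ, ENNReal.ofReal (-(⟪(U : ℝ → AngSpace) ξ, (S : ℝ → AngSpace) ξ⟫_ℂ).re) =
      ∫⁻ t, ENNReal.ofReal
        (-(⟪angSlice (starPull a Φ) (contDiff_two_starPull a hΦ).continuous t r,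
          angSlice (sphLaplacianStar a Φ) (continuous_sphLaplacianStar a hΦ) t r⟫_ℂ).re) := by
    rw [← ofReal_integral_eq_lintegral_ofReal hiUS' hposξ,
      ← ofReal_integral_eq_lintegral_ofReal hiF' hpost, integral_neg_re hiUS, integral_neg_re hiF]
    congr 3
    exact integral_inner_freqLp _ _ hIF _ _ hIS r
  -- Step 4: assemble
  calc _ ≤ _ := h1
    _ = _ := lintegral_freq_split U V S hc
    _ = _ := by rw [h3U, h3V, h4]
    _ ≤ _ := lintegral_three_le_lintegral_ofReal _ _ _ hc
        fun t ↦ neg_inner_angSlice_sphLaplacianStar_re_nonneg a hΦ hr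

end Kerr

end Literature.Geometry.Lorentzian
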